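import Summits.AnomalousDissipation.AnomalousDissipation.Theorems.BaireTransferRobustLoudUpgradeLine
import Summits.AnomalousDissipation.AnomalousDissipation.Theorems.BaireTransferRobustLoudUpgradeStubSteadyPersist
import Summits.AnomalousDissipation.AnomalousDissipation.Theorems.BaireTransferRobustLoudUpgradeStubPeriodicWindow
import Summits.AnomalousDissipation.AnomalousDissipation.Theorems.BaireTransferRobustLoudUpgradePeriodicPersistOfHenry
import Literature.Analysis.FluidPDE.PeriodicNSOrbitPersistsProofs
import Literature.Analysis.FluidPDE.LongTimeAverageNonneg
import Summits.AnomalousDissipation.AnomalousDissipation.Theorems.BaireTransferRobustLoudUpgradeStubWindowExhaust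
import Summits.AnomalousDissipation.AnomalousDissipation.Theorems.BaireTransferRobustLoudUpgradeStubOrbitInW
import Summits.AnomalousDissipation.AnomalousDissipation.Theorems.BaireTransferRobustLoudUpgradeStubLimitEquation
import Summits.AnomalousDissipation.AnomalousDissipation.Theorems.BaireTransferRobustLoudUpgradeStubRealizeTempered
import Summits.AnomalousDissipation.AnomalousDissipation.Theorems.BaireTransferRobustLoudUpgradeStubBudgetLimit
import Summits.AnomalousDissipation.AnomalousDissipation.Theorems.BaireTransferRobustLoudUpgradeTemperedClosed

/-!
# Stub `stub_corrGraphClosed` of the line `malkin-cone-group-orbits`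
# (crux stmt-AnomalousDissipation-1144, `BaireTransfer.RobustLoudUpgrade`, lead c16, wave 2: generic persistence)

The BUDGET-FREE LATTICE-TEMPERED CORRESPONDENCE of the window `n`,
`𝚽[S, n] c = {(ν, τ, m, x) | ν, τ ∈ [1/(n+1), n+1], ‖m‖ ≤ n+1, Σ Λ‖x‖² ≤ n+1, x = Λû the weighted
space–time lattice state of a classical τ-periodic orbit u of NS_ν(f_c) with mean m}`,
has CLOSED GRAPH in `P_S × (ℝ × ℝ × (ℝ³ × ℓ²))`.

Proof (the template is `Tempered.isClosed_latticeWindow`, without the subsequence extraction and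
without budgets): along a convergent sequence of graph points `(cᵢ, νᵢ, τᵢ, mᵢ, xᵢ) → (c, ν, τ, m, x)`
the window bounds are closed conditions (the moment sublevel set `{Σ Λ‖x‖² ≤ ρ}` is closed in `ℓ²`:
it is the intersection over finite sets of modes of sublevel sets of continuous finite sums); the
states `xᵢ = Λûᵢ` are elements of the closed state space `W` (`Tempered.stub_orbitInW`), hence so is
the limit `x`, and `xᵢ → x` in `W`; the projected lattice equation passes to the limit
(`Tempered.stub_limitEquation`, frequencies `τᵢ⁻¹ → τ⁻¹`); the limit state is realized as a classical
`τ`-periodic orbit of `f_c` at viscosity `ν` with mean `m` and lattice data `x/Λ`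
(`Tempered.stub_realizeTempered`), and `Λ (x/Λ) = x` (`sw_cw`).

References: G. Iooss, Arch. Rational Mech. Anal. 47 (1972), §2–3; D. Henry, LNM 840 (1981), Thm. 8.3.2;
H. Kielhöfer, *Bifurcation Theory* (2012), §I.8; the tree files
`Literature/Analysis/FluidPDE/TimePeriodicNSLattice*.lean`, `PeriodicNSOrbitPersistsProofs.lean`.
Pure proof file (no definitions).
-/

set_option linter.dupNamespace false

noncomputable section

open scoped BigOperators Topology ENNReal NNReal ComplexConjugate
open Filter Set Function TopologicalSpace MeasureTheory UnitAddTorus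

namespace Summit.AnomalousDissipation.AnomalousDissipation.Theorems.RobustLoudUpgrade.Tempered

open Literature.Analysis.FunctionSpaces Literature.Analysis.FunctionSpaces.Torus
open Literature.Analysis.FunctionSpaces.EuclideanSpace
open Literature.Analysis.FluidPDE Literature.Analysis.FluidPDE.ScalarFourier
open Literature.Analysis.FluidPDE.TimePeriodicLattice
open Summit.AnomalousDissipation.AnomalousDissipation.Theses.BaireTransfer
open Summit.AnomalousDissipation.AnomalousDissipation.Theorems.RobustLoudUpgrade

-- NOTATION START (verbatim the local notations of `Literature/Analysis/FluidPDE/PeriodicNSOrbitPersistsProofs.lean`)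
/-- The flat unit torus `T³`. -/
local notation "𝕋³" => UnitAddTorus (Fin 3)
/-- Real velocity values. -/
local notation "ℝ³" => EuclideanSpace ℝ (Fin 3)
/-- Complex coefficient values. -/
local notation "ℂ³" => EuclideanSpace ℂ (Fin 3)

/-- Local notation: the parabolic weight `Λ(n, k) = |n| + |k|²`. -/
local notation:max "Λ" m:max => (|((Prod.fst m : ℤ) : ℝ)| + freqNormSq (Prod.snd m))

/-- Local notation: the convective symbol on `ℤ × ℤ³` (as in `TimePeriodicNSLattice`). -/
local notation:max "𝐍[" a ", " b "]" m:max =>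
  (WithLp.toLp 2 (fun p : Fin 3 => ∑ j : Fin 3, ∑' m' : ℤ × (Fin 3 → ℤ),
    a m' j * (dsym j (Prod.snd m - Prod.snd m') * b (m - m') p)) : EuclideanSpace ℂ (Fin 3))

/-- Local notation: division by the weight. -/
local notation:max "𝐜" x:max => (fun mm : ℤ × (Fin 3 → ℤ) =>
  ((((|((Prod.fst mm : ℤ) : ℝ)| + freqNormSq (Prod.snd mm))⁻¹ : ℝ) : ℂ) • x mm))

/-- Local notation: multiplication by the weight. -/
local notation:max "𝐬" x:max => (fun mm : ℤ × (Fin 3 → ℤ) =>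
  ((((|((Prod.fst mm : ℤ) : ℝ)| + freqNormSq (Prod.snd mm)) : ℝ) : ℂ) • x mm))

/-- Local notation: the family of coefficients of `x ∈ W ⊂ ℓ²`. -/
local notation:max "𝐰" x:max =>
  (((x : lp (fun _ : ℤ × (Fin 3 → ℤ) => EuclideanSpace ℂ (Fin 3)) 2)) : ℤ × (Fin 3 → ℤ) → EuclideanSpace ℂ (Fin 3))

/-- Local notation: the symbol `σ_om(n,k) = 2πi om n + 4π²ν|k|² + 2πi m₀·k`. -/
local notation "σ[" om ", " ν ", " m₀ "]" => (fun mm : ℤ × (Fin 3 → ℤ) =>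
  2 * Real.pi * Complex.I * ((om : ℝ) : ℂ) * ((Prod.fst mm : ℤ) : ℂ) +
    (((4 * Real.pi ^ 2 * ν * freqNormSq (Prod.snd mm) : ℝ)) : ℂ) +
    2 * Real.pi * Complex.I * (∑ jj : Fin 3, ((m₀ jj : ℝ) : ℂ) * (((Prod.snd mm) jj : ℤ) : ℂ)))

/-- Local notation: the lattice family of the orbit `u` with period `τ`:
`û(n,k) = 𝓕(complexify ∘ (timeRoll τ u − ∫ u(0)))(n,k)`. -/
local notation:max "𝐨[" τ ", " u "]" => (fun mm : ℤ × (Fin 3 → ℤ) =>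
  mFourierCoeff (EuclideanSpace.complexify ∘ fun y : UnitAddTorus (Fin 4) => Torus.timeRoll τ u y - ∫ x, u 0 x)
    (Fin.cons (Prod.fst mm) (Prod.snd mm) : Fin 4 → ℤ))

/-- Local notation: the force family `y_F(n,k) = [k ≠ 0][n = 0] 𝓕(complexify ∘ F)(k)`. -/
local notation:max "𝐲" F:max => (fun mm : ℤ × (Fin 3 → ℤ) =>
  (ite (Prod.snd mm = 0) (0 : EuclideanSpace ℂ (Fin 3))
    (ite (Prod.fst mm = 0) (mFourierCoeff (EuclideanSpace.complexify ∘ F) (Prod.snd mm)) 0)))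

/-- Local notation: the family of coefficients of an element of `ℓ²(ℤ × ℤ³; ℂ³)`. -/
local notation:max "𝐯" x:max =>
  ((x : lp (fun _ : ℤ × (Fin 3 → ℤ) => EuclideanSpace ℂ (Fin 3)) 2) : ℤ × (Fin 3 → ℤ) → EuclideanSpace ℂ (Fin 3))

/-- Local notation: the BUDGET-FREE LATTICE-TEMPERED CORRESPONDENCE of the window `n` — to a coefficient vector `c` the set of data
`(ν, τ, m, x)` (viscosity, period, mean, weighted lattice state `x = Λû ∈ ℓ²`) of the classical time-periodic solutions of `NS_ν(f_c)`
with `ν, τ ∈ [1/(n+1), n+1]`, `‖m‖ ≤ n+1`, `Σ Λ‖x‖² ≤ n+1`. -/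
local notation "𝚽[" S ", " n "]" => (fun c : Coeff S => setOf
  (fun q : ℝ × ℝ × (EuclideanSpace ℝ (Fin 3) × lp (fun _ : ℤ × (Fin 3 → ℤ) => EuclideanSpace ℂ (Fin 3)) 2) =>
    1 / ((n : ℝ) + 1) ≤ (Prod.fst q) ∧ (Prod.fst q) ≤ (n : ℝ) + 1 ∧ 1 / ((n : ℝ) + 1) ≤ (Prod.fst (Prod.snd q)) ∧ (Prod.fst (Prod.snd q)) ≤ (n : ℝ) + 1 ∧
    ‖(Prod.fst (Prod.snd (Prod.snd q)))‖ ≤ (n : ℝ) + 1 ∧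
    (∑' mm : ℤ × (Fin 3 → ℤ), ENNReal.ofReal (Λ mm) * ‖(𝐯 ((Prod.snd (Prod.snd (Prod.snd q))))) mm‖ₑ ^ 2) ≤ ENNReal.ofReal ((n : ℝ) + 1) ∧
    ∃ (u : ℝ → UnitAddTorus (Fin 3) → EuclideanSpace ℝ (Fin 3)) (p : ℝ → UnitAddTorus (Fin 3) → ℝ),
      IsClassicalNSSolutionOn Set.univ (Prod.fst q) (fun _ => force S c) u p ∧ Function.Periodic u (Prod.fst (Prod.snd q)) ∧
      (∫ y, u 0 y) = (Prod.fst (Prod.snd (Prod.snd q))) ∧ 𝐯 ((Prod.snd (Prod.snd (Prod.snd q)))) = 𝐬 𝐨[(Prod.fst (Prod.snd q)), u]))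
-- NOTATION END

/-! ## Auxiliary: the moment sublevel sets are closed in `ℓ²` -/

namespace CorrGraphClosedAux

-- adapted from Literature/Analysis/FluidPDE/TimePeriodicNSLatticeCompact.lean (`isCompact_wt_le`, closedness block)
/-- A single weighted term `x ↦ Λ(m) ‖x(m)‖²` (valued in `ℝ≥0∞`) is continuous on `ℓ²(ℤ × ℤ³; ℂ³)`:
the coordinate `x ↦ x(m)` is continuous (`l2_continuous_apply`). [folklore] -/
theorem continuous_moment_term (m : ℤ × (Fin 3 → ℤ)) :
    Continuous fun x : lp (fun _ : ℤ × (Fin 3 → ℤ) => ℂ³) 2 => ENNReal.ofReal (Λ m) * ‖(𝐯 x) m‖ₑ ^ 2 := by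
  have e : (fun x : lp (fun _ : ℤ × (Fin 3 → ℤ) => ℂ³) 2 => ENNReal.ofReal (Λ m) * ‖(𝐯 x) m‖ₑ ^ 2) =
      fun x => ENNReal.ofReal (Λ m * ‖(𝐯 x) m‖ ^ 2) := by
    funext x
    rw [ENNReal.ofReal_mul (wt_nonneg m), ENNReal.ofReal_pow (norm_nonneg _), ofReal_norm]
  rw [e]
  exact ENNReal.continuous_ofReal.comp (continuous_const.mul ((l2_continuous_apply m).norm.pow 2))

/-- The moment sublevel set `{x ∈ ℓ² | Σ_m Λ(m) ‖x(m)‖² ≤ ρ}` is CLOSED in `ℓ²(ℤ × ℤ³; ℂ³)`: since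
`Σ_m = sup` of the finite partial sums, it is the intersection over the finite sets of modes of the sublevel
sets of continuous finite sums. [folklore] -/
theorem isClosed_moment_le (ρ : ℝ≥0∞) :
    IsClosed {x : lp (fun _ : ℤ × (Fin 3 → ℤ) => ℂ³) 2 | ∑' m, ENNReal.ofReal (Λ m) * ‖(𝐯 x) m‖ₑ ^ 2 ≤ ρ} := by
  have e : {x : lp (fun _ : ℤ × (Fin 3 → ℤ) => ℂ³) 2 | ∑' m, ENNReal.ofReal (Λ m) * ‖(𝐯 x) m‖ₑ ^ 2 ≤ ρ} =
      ⋂ Fs : Finset (ℤ × (Fin 3 → ℤ)),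
        {x : lp (fun _ : ℤ × (Fin 3 → ℤ) => ℂ³) 2 | ∑ m ∈ Fs, ENNReal.ofReal (Λ m) * ‖(𝐯 x) m‖ₑ ^ 2 ≤ ρ} := by
    ext x
    simp only [Set.mem_setOf_eq, Set.mem_iInter, ENNReal.tsum_eq_iSup_sum, iSup_le_iff]
  rw [e]
  exact isClosed_iInter fun Fs =>
    isClosed_le (continuous_finsetSum Fs fun m _ => continuous_moment_term m) continuous_const

end CorrGraphClosedAux

/-! ## The correspondence has closed graph -/

open CorrGraphClosedAux in
/-- **stub_corrGraphClosed** (the budget-free lattice-tempered correspondence has CLOSED GRAPH): the set of pairs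
`(c, q)`, `q = (ν, τ, m, x) ∈ 𝚽[S,n] c`, is closed in `P_S × (ℝ × ℝ × (ℝ³ × ℓ²))`.  Pattern
`Tempered.isClosed_latticeWindow` without the extraction and without budgets — along `(cᵢ, qᵢ) → (c, q)` with
`qᵢ ∈ 𝚽[S,n] cᵢ` the window bounds are closed conditions (the moment sublevel set is closed,
`CorrGraphClosedAux.isClosed_moment_le`), the states `xᵢ = Λûᵢ` lie in the closed state space `W`
(`Tempered.stub_orbitInW`, `exists_space`) and converge there to `x ∈ W`, the projected lattice equation passes to
the limit (`Tempered.stub_limitEquation`), the limit state is realized as a classical periodic orbit of `f_c` with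
the limit data (`Tempered.stub_realizeTempered`), and `x = Λû` for the realized orbit (`sw_cw`). [folklore] -/
theorem stub_corrGraphClosed : ∀ (S : Finset (Fin 3 → ℤ)) (n : ℕ),
    IsClosed {cq : Coeff S × (ℝ × ℝ × (EuclideanSpace ℝ (Fin 3) × lp (fun _ : ℤ × (Fin 3 → ℤ) => EuclideanSpace ℂ (Fin 3)) 2)) |
      cq.2 ∈ 𝚽[S, n] cq.1} := by
  intro S n
  refine IsSeqClosed.isClosed fun z zl hmem hlim => ?_
  -- name the components of the sequence and of the limit
  obtain ⟨cs, νs, τs, ms, xs, rfl⟩ : ∃ (cs : ℕ → Coeff S) (νs τs : ℕ → ℝ) (ms : ℕ → ℝ³)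
      (xs : ℕ → lp (fun _ : ℤ × (Fin 3 → ℤ) => ℂ³) 2), (fun i => (cs i, νs i, τs i, ms i, xs i)) = z :=
    ⟨fun i => (z i).1, fun i => (z i).2.1, fun i => (z i).2.2.1, fun i => (z i).2.2.2.1,
      fun i => (z i).2.2.2.2, rfl⟩
  obtain ⟨cl, νl, τl, ml, xl⟩ := zl
  simp only [Set.mem_setOf_eq] at hmem
  choose hν₁ hν₂ hτ₁ hτ₂ hmn hmom us ps hsol hper hmean hdata using hmem
  -- positivity of the periods
  have hn1 : (0 : ℝ) < (n : ℝ) + 1 := by positivity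
  have hτ : ∀ i, 0 < τs i := fun i => (one_div_pos.2 hn1).trans_le (hτ₁ i)
  -- component limits
  have hclim : Tendsto cs atTop (𝓝 cl) := (continuous_fst.tendsto _).comp hlim
  have hνlim : Tendsto νs atTop (𝓝 νl) :=
    (continuous_fst.tendsto _).comp ((continuous_snd.tendsto _).comp hlim)
  have hτlim : Tendsto τs atTop (𝓝 τl) :=
    (continuous_fst.tendsto _).comp ((continuous_snd.tendsto _).comp ((continuous_snd.tendsto _).comp hlim))
  have hmlim : Tendsto ms atTop (𝓝 ml) :=
    (continuous_fst.tendsto _).comp ((continuous_snd.tendsto _).comp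
      ((continuous_snd.tendsto _).comp ((continuous_snd.tendsto _).comp hlim)))
  have hxlim : Tendsto xs atTop (𝓝 xl) :=
    (continuous_snd.tendsto _).comp ((continuous_snd.tendsto _).comp
      ((continuous_snd.tendsto _).comp ((continuous_snd.tendsto _).comp hlim)))
  -- the closed window bounds pass to the limit
  have hνl₁ : 1 / ((n : ℝ) + 1) ≤ νl := ge_of_tendsto' hνlim hν₁
  have hνl₂ : νl ≤ (n : ℝ) + 1 := le_of_tendsto' hνlim hν₂
  have hτl₁ : 1 / ((n : ℝ) + 1) ≤ τl := ge_of_tendsto' hτlim hτ₁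
  have hτl₂ : τl ≤ (n : ℝ) + 1 := le_of_tendsto' hτlim hτ₂
  have hmln : ‖ml‖ ≤ (n : ℝ) + 1 := le_of_tendsto' hmlim.norm hmn
  have hmoml : (∑' mm : ℤ × (Fin 3 → ℤ), ENNReal.ofReal (Λ mm) * ‖(𝐯 xl) mm‖ₑ ^ 2) ≤
      ENNReal.ofReal ((n : ℝ) + 1) :=
    (isClosed_moment_le _).mem_of_tendsto hxlim (Eventually.of_forall hmom)
  have hνl : 0 < νl := (one_div_pos.2 hn1).trans_le hνl₁
  have hτl : 0 < τl := (one_div_pos.2 hn1).trans_le hτl₁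
  -- the state space and the states of the orbits
  obtain ⟨W, hW, hWc⟩ := exists_space
  choose x₀ hx₀ heq₀ using fun i => stub_orbitInW hW (cs i) (hτ i) (hsol i) (hper i)
  have hzero : ∀ i (k : ℤ), 𝐨[τs i, us i] (k, 0) = 0 := fun i k =>
    orbit_zero_modes (hsol i) (hper i) (SteadyPersist.hasZeroMean_force' _) k
  have hcx : ∀ i, 𝐜 (𝐰 (x₀ i)) = 𝐨[τs i, us i] := fun i => by
    rw [hx₀ i]; exact cw_sw (x := 𝐨[τs i, us i]) (hzero i)
  -- the states are the given `ℓ²` data: the limit datum lies in the closed space `W`, and the states converge in `W`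
  have hcoe : ∀ i, ((x₀ i : W) : lp (fun _ : ℤ × (Fin 3 → ℤ) => ℂ³) 2) = xs i := fun i =>
    lp.ext ((hx₀ i).trans (hdata i).symm)
  have hxW : ∀ i, xs i ∈ W := fun i => by rw [← hcoe i]; exact (x₀ i).2
  have hxlW : xl ∈ W := hWc.mem_of_tendsto hxlim (Eventually.of_forall hxW)
  obtain ⟨xW, hxWl⟩ : ∃ xW : W, (xW : lp (fun _ : ℤ × (Fin 3 → ℤ) => ℂ³) 2) = xl := ⟨⟨xl, hxlW⟩, rfl⟩
  have hx₀lim : Tendsto x₀ atTop (𝓝 xW) := by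
    rw [tendsto_subtype_rng, hxWl]
    exact hxlim.congr fun i => (hcoe i).symm
  -- the lattice equation along the sequence (frequencies `τᵢ⁻¹`), and in the limit
  have homlim : Tendsto (fun i => (τs i)⁻¹) atTop (𝓝 τl⁻¹) := hτlim.inv₀ hτl.ne'
  have heqs : ∀ i : ℕ, ∀ mm : ℤ × (Fin 3 → ℤ), mm.2 ≠ 0 →
      σ[(τs i)⁻¹, νs i, ms i] mm • (𝐜 (𝐰 (x₀ i))) mm +
        Torus.lerayCoeff mm.2 (𝐍[𝐜 (𝐰 (x₀ i)), 𝐜 (𝐰 (x₀ i))] mm) = (𝐲 (force S (cs i))) mm := by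
    intro i mm hmm
    rw [hcx i, ← hmean i]
    exact heq₀ i mm hmm
  have heql := stub_limitEquation hW x₀ xW hx₀lim (fun i => (τs i)⁻¹) νs τl⁻¹ νl homlim hνlim ms ml hmlim
    cs cl hclim heqs
  -- realization of the limit state as a classical periodic orbit with the limit data
  obtain ⟨ul, pl, hsoll, hperl, hmeanl, hdatal⟩ :=
    stub_realizeTempered hW cl xW (inv_pos.2 hτl) hνl ml heql
  simp only [inv_inv] at hperl hdatal
  have hdat : 𝐯 xl = 𝐬 𝐨[τl, ul] := by
    rw [hdatal, sw_cw (W_zero hW xW), hxWl]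
  -- graph membership of the limit
  exact ⟨hνl₁, hνl₂, hτl₁, hτl₂, hmln, hmoml, ul, pl, hsoll, hperl, hmeanl, hdat⟩

end Summit.AnomalousDissipation.AnomalousDissipation.Theorems.RobustLoudUpgrade.Tempered

end
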